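import Summits.QuantumFields.BalabanUV.T4Continuum.Support.MinimalActionThm1Type
import Summits.QuantumFields.BalabanUV.T4Continuum.Support.MinimalActionExistenceCapstone
import Summits.QuantumFields.BalabanUV.T4Continuum.Support.LevelZeroRegular
import Summits.QuantumFields.BalabanUV.T4Continuum.Support.NE3ShapeCrudeWitness
import HarnessLib

/-!
# NE7EtaBackgroundRefineThresholds — route #1 of the NE7 crux, stub S7 (NODE O, the BACKGROUND COORDINATE), part 1 of the (H2) discharge:
# `SmoothRefine` on the small-field class and the (H2) REFINEMENT SHAPE of `NE7EtaBackgroundBinders.hclose_of_refine_regular_letter` (p259117)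
# from the NE3 crew's PROVED kinematic refinement, BY NAME; the thresholds at `d = 4` below ONE displayed numeral

Cell `pub-balaban`, rung (B)+1 sub-cell t4, lineage `b2b-balaban-t4-ne7-p1`, generation 27 (CRUX PROVER NE7 #1, ruling e34b3e0c); crux
skeleton `t4/skeletons/NE7-CRUX-R1.md` v1.7.7 §0bis item 7 ∕ §3septies ∕ §5 (G5).  HONEST FRAMING (page 1): FIXED FINITE T⁴, rung (B)+1; NE7, NE3
NOT PRINTED in [Balaban1984PropagatorsI]–[Balaban1989LargeFieldII] and NOT PROVED here; continuum YM on T⁴ ⇐ BetaPertH ∧ nine spine estimates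
(0/9 proved); BetaPertH ⇐ (D1) ∧ (D4) ∧ CAP+tail; G-an2-4 gates asym, D1 and NE2/3/4; NOT infinite volume, NOT mass gap, NOT Clay.

WHY THIS FILE.  After gen 26 the `hclose`∕`hδ` binder of NODE O's background coordinate (`NE7EtaBackgroundGaugeLetterDischarge.hclose_of_refine_regular`,
p263433) costs row NE3's covariant root `h`, row NE3's binders (H2) `h2` («every minimiser of every `sfClass` run is the rescaled one-step average
of SOME configuration of the next class») and (H3) `h3` (`Regular`), the smallness letters and the sector condition.  (H2) is consumed ONLY through
`MinimalActionExistence.exists_isMinimiser_of_refine` (existence of run-A∕run-B minimisers by compactness).  The NE3 crew (rows R1∕R2∕A-H1-cpt of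
`t4/formal/NE3/LEAVES.md`) has PROVED the kinematic lemma behind (H2): `ApproxRefineEnd.approxRefine_sfClass` (approximate covariant refinement of
every sup-form regular configuration of the class, CLOSED constants, side conditions by `ApproxRefineRegime.sideConds_of_small`),
`ChainEndExact.exists_exact_refinement` (exactness of the block-average constraint) packaged as `SmoothRefineOfApprox.smoothRefine_of_approxRefine`,
the regime bookkeeping `MinimalActionFinalApprox.regime_of_linear_bounds` ∕ `MinimalActionRegime.sideConds_of_regime` ∕
`MinimalActionMismatchSmall.mismatch_le_of_small`, and `MinimalActionExistence(Capstone).exists_(regular_)isMinimiser_of_smoothRefine` ((H1) from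
(H0) + (H3ˢᵘᵖ) + `SmoothRefine`).  THIS FILE composes them BY NAME (0 `def`, 0 sorry, no new mathematics):

* §1 (any `d`) **`smoothRefine_sfClass_thm1Type`** — under thresholds (i)(ii)(iii) and the class-radius letter of
  `MinimalActionThm1Type.actionRate_thm1Type_class` VERBATIM (`0 ≤ b ≤ t`, `0 ≤ c ≤ t`): `b ≤ ε ∧ ∃ b′ c′, SmoothRefine d (sfClass d L N ε) L N b c b′ c′`;
  **`refine_of_smoothRefine`** — `SmoothRefine` + (H3ˢᵘᵖ) «every minimiser of runs `k+1` is `RegularSup d L N b c (k+1)`» + the data class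
  `dom ⊆ sfClass d L N ε₁ 0` (`ε₁ ≤ 1∕4`, `ε₁ ≤ b`, `4ε₁ ≤ c`, so (H0) holds by `LevelZeroRegular.regularSup_zero_of_sfClass_le`) ⇒ THE SHAPE `h2` of
  p259117∕p263433 LITERALLY; **`exists_regular_isMinimiser_thm1Type`** — the (H∃) binder `hmin` of `MinimalActionThm1Type.actionRate_sfClass_thm1Type`
  («at every level SOME minimiser with sup-form regularity `(b, c)`») from (H3ˢᵘᵖ) + the data class + the thresholds + the compactness regime of
  `MinimalActionExistence` (`L ≥ 2`, `16·C₀(d)·ε ≤ 3`, `1024(d+1)(d+4)L²ε ≤ 1`) — no standalone END of this shape was in the tree.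
* §2 (`d = 4`) numerics (`NE3ShapeCrudeWitness.gradRem_four`: `gradRem 4 = 3588`): **`thresholds_four`** — ONE displayed threshold `2^91·L^17·t ≤ 1` implies (i)(ii)(iii) at `d = 4`
  (the displayed coefficient polynomials sum to `2059282960402987964837849120 < 2^91`, every power of `L` at most `17`); **`classRadius_four`** —
  `2^76·L^12·t ≤ ε` implies the class-radius letter at `d = 4` (coefficients sum to `56559895763021513668152 < 2^76`, powers at most `12`).
Part 2 (`NE7EtaBackgroundRefineDischarge`) feeds these into p263433.
HONEST: composition only; the binder concerned is KINEMATIC (lattice-gauge kinematics proved by the NE3 crew), not an estimate of Bałaban's; the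
numeric thresholds are honest box counting (`t ≤ 2^{-91}L^{-17}`), not optimised; (H3ˢᵘᵖ) is [Balaban1985Variational] Thm 1 (8)+(10) p. 279 TYPE,
asserted for no configuration; NE3∕NE7 NOT proved; 0 def; 0 sorry.
-/

set_option autoImplicit false

open scoped BigOperators Matrix Matrix.Norms.L2Operator
open Finset NormedSpace

namespace Summit.QuantumFields.BalabanUV.T4Continuum.NE7EtaBackgroundRefineThresholds

open Literature.MathematicalPhysics.QuantumFieldTheory.Balaban1983to89
open B7Prop1Explicit B7Prop2Explicit
open T4AveragingDeficitWall hiding Site Plane Plaq Bond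
open MinimalActionSandwich (IsMinimiser)
open MinimalActionRate (Regular sfClass)
open MinimalActionRefine (RegularSup SmoothRefine gradConst gradConst_nonneg regularSup_of_isMinimiser_zero)
open SmoothRefineOfApprox (smoothRefine_of_approxRefine)
open ChainEndFix (gap)
open MinimalActionFinalApprox (regime_of_linear_bounds)
open MinimalActionMismatchSmall (fillRadius_nonneg mismatch_nonneg mismatch_le_of_small)
open MinimalActionRegime (sideConds_of_regime)
open SkeletonPrecompGrad (gradRem gradRem_nonneg)
open ApproxRefineRegime (sideConds_of_small fillRadius_le_of_small)
open ApproxRefineEnd (approxRefine_sfClass)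
open MinimalActionExistence (exists_isMinimiser_of_smoothRefine)
open MinimalActionExistenceCapstone (exists_regular_isMinimiser_of_smoothRefine)
open LevelZeroRegular (regularSup_zero_of_sfClass_le)
open NE3ShapeCrudeWitness (gradRem_four)

noncomputable section

/-! ## §1 `SmoothRefine` on the small-field class and the (H2) shape from the crew's leaf R1∕R2 ENDs (any `d`) -/

section AnyD

variable {d : ℕ} {n : Type*} [Fintype n] [DecidableEq n] [Nonempty n]

/-- **`SmoothRefine` ON THE SMALL-FIELD CLASS FROM B11-THEOREM-1-TYPE RADII ALONE.**  For `d ≥ 1`, `L ≥ 1`, radii `0 ≤ b ≤ t`, `0 ≤ c ≤ t` below the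
thresholds (i)(ii)(iii) of `MinimalActionThm1Type.actionRate_thm1Type_class` (VERBATIM) and a class radius `ε` above its class-radius letter
(VERBATIM): `b ≤ ε` and `SmoothRefine d (sfClass d L N ε) L N b c b′ c′` for SOME `b′, c′` — the crew's `approxRefine_sfClass` (leaf R1) made exact by
`smoothRefine_of_approxRefine` (leaf R2), its regime discharged by `regime_of_linear_bounds` ∕ `sideConds_of_regime` with the envelopes
`fillRadius_le_of_small` ∕ `mismatch_le_of_small`.  Composition only. [folklore] -/
theorem smoothRefine_sfClass_thm1Type (hd : 1 ≤ d) {L : ℕ} (N : ℕ) (hL : 1 ≤ L) {b c t ε : ℝ}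
    (hb : 0 ≤ b) (hc : 0 ≤ c) (hbt : b ≤ t) (hct : c ≤ t)
    (hT1 : (160 * d + 168 * (d : ℝ) ^ 2 + 2 * (32 * d + (24 * d * (2 * (d : ℝ) + gradRem d) + 14336 * (d : ℝ) ^ 2 * ((d : ℝ) + 1) ^ 2)
            + 12 * (2 * (d : ℝ) + gradRem d))
        + 512 * ((d : ℝ) + 1) * ((d : ℝ) + 4) * (L : ℝ) ^ 2
          * (32 * d + 48 * d * (L : ℝ) ^ 2 * (2 * (d : ℝ) + gradRem d)
            + 8192 * (d : ℝ) ^ 2 * (2 * (d : ℝ) + 1) ^ 2 * (L : ℝ) ^ 2)) * t ≤ 1)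
    (hT2 : 2 ^ 15 * ((d : ℝ) + 1) ^ 2 * ((d : ℝ) + 4) ^ 2 * (L : ℝ) ^ 2 * t ≤ 1)
    (hT3 : 2 ^ 14 * ((d : ℝ) + 1) * ((d : ℝ) + 4) * (L : ℝ) ^ (2 * d + 3)
          * ((32 * d + 48 * d * (L : ℝ) ^ 2 * (2 * (d : ℝ) + gradRem d)
              + 8192 * (d : ℝ) ^ 2 * (2 * (d : ℝ) + 1) ^ 2 * (L : ℝ) ^ 2)
            + (3 * (1280 * d * ((d : ℝ) + 1) ^ 2 * ((d : ℝ) + 4) ^ 2 * (L : ℝ) ^ 2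
            * (32 * d + 48 * d * (L : ℝ) ^ 2 * (2 * (d : ℝ) + gradRem d)
              + 8192 * (d : ℝ) ^ 2 * (2 * (d : ℝ) + 1) ^ 2 * (L : ℝ) ^ 2) ^ 2
          + d * ((d : ℝ) + 1) * ((L : ℝ) ^ 3 * (256 * (d : ℝ) ^ 2
              * (32 * d + (24 * d * (2 * (d : ℝ) + gradRem d) + 14336 * (d : ℝ) ^ 2 * ((d : ℝ) + 1) ^ 2)
                + 12 * (2 * (d : ℝ) + gradRem d))
            + 4 * (24 * d * (2 * (d : ℝ) + gradRem d) + 14336 * (d : ℝ) ^ 2 * ((d : ℝ) + 1) ^ 2)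
            + 24 * (2 * (d : ℝ) + gradRem d)))
          + ((d : ℝ) - 1) ^ 2 * (37 * ((d : ℝ) - 1) + 5)))) * t ≤ 1)
    (hεt : 18 * ((32 * d + 48 * d * (L : ℝ) ^ 2 * (2 * (d : ℝ) + gradRem d)
              + 8192 * (d : ℝ) ^ 2 * (2 * (d : ℝ) + 1) ^ 2 * (L : ℝ) ^ 2)
            + (3 * (1280 * d * ((d : ℝ) + 1) ^ 2 * ((d : ℝ) + 4) ^ 2 * (L : ℝ) ^ 2
            * (32 * d + 48 * d * (L : ℝ) ^ 2 * (2 * (d : ℝ) + gradRem d)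
              + 8192 * (d : ℝ) ^ 2 * (2 * (d : ℝ) + 1) ^ 2 * (L : ℝ) ^ 2) ^ 2
          + d * ((d : ℝ) + 1) * ((L : ℝ) ^ 3 * (256 * (d : ℝ) ^ 2
              * (32 * d + (24 * d * (2 * (d : ℝ) + gradRem d) + 14336 * (d : ℝ) ^ 2 * ((d : ℝ) + 1) ^ 2)
                + 12 * (2 * (d : ℝ) + gradRem d))
            + 4 * (24 * d * (2 * (d : ℝ) + gradRem d) + 14336 * (d : ℝ) ^ 2 * ((d : ℝ) + 1) ^ 2)
            + 24 * (2 * (d : ℝ) + gradRem d)))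
          + ((d : ℝ) - 1) ^ 2 * (37 * ((d : ℝ) - 1) + 5)))) * (L : ℝ) ^ (d + 2) * t ≤ ε) :
    b ≤ ε ∧ ∃ b' c' : ℝ, SmoothRefine d (sfClass (n := n) d L N ε) L N b c b' c' := by
  have hL1 : (1 : ℝ) ≤ L := by exact_mod_cast hL
  have hd1 : (1 : ℝ) ≤ d := by exact_mod_cast hd
  have hd0 : (0 : ℝ) ≤ d := by positivity
  have ht0 : 0 ≤ t := hb.trans hbt
  have hΓ := gradRem_nonneg hd
  -- `t ≤ 1` from (ii)
  have ht1 : t ≤ 1 := by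
    have h1' : (1 : ℝ) ≤ ((d : ℝ) + 1) ^ 2 := one_le_pow₀ (by linarith)
    have h4' : (1 : ℝ) ≤ ((d : ℝ) + 4) ^ 2 := one_le_pow₀ (by linarith)
    have hL2 : (1 : ℝ) ≤ (L : ℝ) ^ 2 := one_le_pow₀ hL1
    have hc2 : (1 : ℝ) ≤ 2 ^ 15 * ((d : ℝ) + 1) ^ 2 * ((d : ℝ) + 4) ^ 2 * (L : ℝ) ^ 2 :=
      one_le_mul_of_one_le_of_one_le (one_le_mul_of_one_le_of_one_le
        (one_le_mul_of_one_le_of_one_le (by norm_num) h1') h4') hL2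
    have := mul_le_mul_of_nonneg_right hc2 ht0
    linarith
  -- the crew's R1 END and the envelopes (all stated with the displayed closed expressions)
  obtain ⟨h16, hdb, hquarter, hhalf, h512⟩ := sideConds_of_small hd hL hb hc hbt hct hT1
  have hA := approxRefine_sfClass (n := n) hd L N hL (ε := ε) hb hc h16 hdb hquarter hhalf h512
  have hB1 := fillRadius_le_of_small hd L hb hbt hct ht1
  have hB0 := fillRadius_nonneg hd L hb hc
  have hM1 := mismatch_le_of_small hd L hb hc hbt hct ht1
  have hM0 := mismatch_nonneg hd L hb hc
  have hKB0 : 0 ≤ (32 * d + 48 * d * (L : ℝ) ^ 2 * (2 * (d : ℝ) + gradRem d)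
              + 8192 * (d : ℝ) ^ 2 * (2 * (d : ℝ) + 1) ^ 2 * (L : ℝ) ^ 2) := by positivity
  have hKB1 : 1 ≤ (32 * d + 48 * d * (L : ℝ) ^ 2 * (2 * (d : ℝ) + gradRem d)
              + 8192 * (d : ℝ) ^ 2 * (2 * (d : ℝ) + 1) ^ 2 * (L : ℝ) ^ 2) := by
    have h48 : 0 ≤ 48 * d * (L : ℝ) ^ 2 * (2 * (d : ℝ) + gradRem d) := by positivity
    have h8192 : 0 ≤ 8192 * (d : ℝ) ^ 2 * (2 * (d : ℝ) + 1) ^ 2 * (L : ℝ) ^ 2 := by positivity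
    linarith
  have hKM0 : 0 ≤ (3 * (1280 * d * ((d : ℝ) + 1) ^ 2 * ((d : ℝ) + 4) ^ 2 * (L : ℝ) ^ 2
            * (32 * d + 48 * d * (L : ℝ) ^ 2 * (2 * (d : ℝ) + gradRem d)
              + 8192 * (d : ℝ) ^ 2 * (2 * (d : ℝ) + 1) ^ 2 * (L : ℝ) ^ 2) ^ 2
          + d * ((d : ℝ) + 1) * ((L : ℝ) ^ 3 * (256 * (d : ℝ) ^ 2
              * (32 * d + (24 * d * (2 * (d : ℝ) + gradRem d) + 14336 * (d : ℝ) ^ 2 * ((d : ℝ) + 1) ^ 2)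
                + 12 * (2 * (d : ℝ) + gradRem d))
            + 4 * (24 * d * (2 * (d : ℝ) + gradRem d) + 14336 * (d : ℝ) ^ 2 * ((d : ℝ) + 1) ^ 2)
            + 24 * (2 * (d : ℝ) + gradRem d)))
          + ((d : ℝ) - 1) ^ 2 * (37 * ((d : ℝ) - 1) + 5))) := by
    have h37 : 0 ≤ 37 * ((d : ℝ) - 1) + 5 := by linarith
    positivity
  -- linear bounds with the common constant `K_b + K_m ≥ 1`
  have hKsum := le_add_of_le_of_nonneg hKB1 hKM0
  have hB1' := hB1.trans (mul_le_mul_of_nonneg_right (le_add_of_nonneg_right hKM0) ht0)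
  have hM1' := hM1.trans (mul_le_mul_of_nonneg_right (le_add_of_nonneg_left hKB0) ht0)
  obtain ⟨hRb, hRr, hRε⟩ := regime_of_linear_bounds hd hL ht0 hKsum hbt hB1' hM1' hT2 hT3
  obtain ⟨-, hbε, hbs₁, hgap, hhalf', hε'⟩ := sideConds_of_regime hL hb hB0 hM0 hRb hRr (hRε.trans hεt)
  refine ⟨?_, _, _, smoothRefine_of_approxRefine hL hB0 hM0 hbs₁ hgap hhalf' hε' hA⟩
  have hsq : 0 ≤ 226 * (8 * ((d : ℝ) + 1) * ((d : ℝ) + 4)) ^ 2 * b ^ 2 := by positivity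
  linarith

omit [Nonempty n] in
/-- **THE (H2) SHAPE FROM `SmoothRefine` + (H3ˢᵘᵖ) + THE DATA CLASS.**  If `SmoothRefine d (sfClass d L N ε) L N b c b′ c′` holds, the data lie in
`sfClass d L N ε₁ 0` with `ε₁ ≤ 1∕4`, `ε₁ ≤ b`, `4ε₁ ≤ c` (so every datum is `RegularSup d L N b c 0`, `LevelZeroRegular.regularSup_zero_of_sfClass_le`),
and (H3ˢᵘᵖ) every minimiser of every run `k+1` is `RegularSup d L N b c (k+1)`, then EVERY minimiser of EVERY run `k` is the rescaled one-step
average of SOME configuration of `sfClass d L N ε (k+1)` — LITERALLY the binder `h2` of `NE7EtaBackgroundBinders.hclose_of_refine_regular_letter`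
(p259117) ∕ `NE7EtaBackgroundGaugeLetterDischarge.hclose_of_refine_regular` (p263433) (at `k = 0` the minimiser is the datum,
`MinimalActionRefine.regularSup_of_isMinimiser_zero`).  Composition only. [folklore] -/
theorem refine_of_smoothRefine {L N : ℕ} {b c b' c' ε ε₁ : ℝ} (hε₁ : ε₁ ≤ 1 / 4) (hε₁b : ε₁ ≤ b) (hε₁c : 4 * ε₁ ≤ c)
    (hR : SmoothRefine d (sfClass (n := n) d L N ε) L N b c b' c')
    {dom : Set (Site d → Fin d → (Matrix n n ℂ)ˣ)} (hdom1 : dom ⊆ sfClass d L N ε₁ 0)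
    (h3 : ∀ V ∈ dom, ∀ (k : ℕ) (U : Site d → Fin d → (Matrix n n ℂ)ˣ),
      IsMinimiser d (sfClass d L N ε) L N (k + 1) V U → RegularSup d L N b c (k + 1) U) :
    ∀ V ∈ dom, ∀ (k : ℕ) (U : Site d → Fin d → (Matrix n n ℂ)ˣ), IsMinimiser d (sfClass d L N ε) L N k V U →
      ∃ Ut, Ut ∈ sfClass d L N ε (k + 1) ∧ rescale L (bavg L Ut) = U := by
  intro V hV k U hU
  have h0 : RegularSup d L N b c 0 V := regularSup_zero_of_sfClass_le hε₁ hε₁b hε₁c (hdom1 hV)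
  have hreg : RegularSup d L N b c k U := by
    cases k with
    | zero => exact regularSup_of_isMinimiser_zero h0 hU
    | succ k => exact h3 V hV k U hU
  obtain ⟨Ut, hmem, havg, -⟩ := hR k U hU.mem.1 hreg
  exact ⟨Ut, hmem, havg⟩

/-- **(H∃) FROM (H3ˢᵘᵖ) UNDER THE THRESHOLDS** — the binder `hmin` of `MinimalActionThm1Type.actionRate_sfClass_thm1Type` («every datum of `dom` has
at every level SOME minimiser over `sfClass d L N ε` with sup-form regularity `(b, c)`») follows from (H3ˢᵘᵖ) for the minimisers of runs `k+1`,
the data class `dom ⊆ sfClass d L N ε₁ 0` (`ε₁ ≤ 1∕4`, `ε₁ ≤ b`, `4ε₁ ≤ c`), thresholds (i)(ii)(iii) + the class-radius letter (VERBATIM), and the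
compactness regime of `MinimalActionExistence` (`L ≥ 2`, `16·C₀(d)·ε ≤ 3`, `1024(d+1)(d+4)L²ε ≤ 1`):
`MinimalActionExistenceCapstone.exists_regular_isMinimiser_of_smoothRefine` ∘ `smoothRefine_sfClass_thm1Type`.  NE3 is NOT proved: (H3ˢᵘᵖ) is
[Balaban1985Variational] Thm 1 (8)+(10) p. 279 TYPE, asserted for nothing. [folklore] -/
theorem exists_regular_isMinimiser_thm1Type (hd : 1 ≤ d) {L N : ℕ} (hL : 2 ≤ L) {b c t ε ε₁ : ℝ}
    (hb : 0 ≤ b) (hc : 0 ≤ c) (hbt : b ≤ t) (hct : c ≤ t)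
    (hT1 : (160 * d + 168 * (d : ℝ) ^ 2 + 2 * (32 * d + (24 * d * (2 * (d : ℝ) + gradRem d) + 14336 * (d : ℝ) ^ 2 * ((d : ℝ) + 1) ^ 2)
            + 12 * (2 * (d : ℝ) + gradRem d))
        + 512 * ((d : ℝ) + 1) * ((d : ℝ) + 4) * (L : ℝ) ^ 2
          * (32 * d + 48 * d * (L : ℝ) ^ 2 * (2 * (d : ℝ) + gradRem d)
            + 8192 * (d : ℝ) ^ 2 * (2 * (d : ℝ) + 1) ^ 2 * (L : ℝ) ^ 2)) * t ≤ 1)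
    (hT2 : 2 ^ 15 * ((d : ℝ) + 1) ^ 2 * ((d : ℝ) + 4) ^ 2 * (L : ℝ) ^ 2 * t ≤ 1)
    (hT3 : 2 ^ 14 * ((d : ℝ) + 1) * ((d : ℝ) + 4) * (L : ℝ) ^ (2 * d + 3)
          * ((32 * d + 48 * d * (L : ℝ) ^ 2 * (2 * (d : ℝ) + gradRem d)
              + 8192 * (d : ℝ) ^ 2 * (2 * (d : ℝ) + 1) ^ 2 * (L : ℝ) ^ 2)
            + (3 * (1280 * d * ((d : ℝ) + 1) ^ 2 * ((d : ℝ) + 4) ^ 2 * (L : ℝ) ^ 2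
            * (32 * d + 48 * d * (L : ℝ) ^ 2 * (2 * (d : ℝ) + gradRem d)
              + 8192 * (d : ℝ) ^ 2 * (2 * (d : ℝ) + 1) ^ 2 * (L : ℝ) ^ 2) ^ 2
          + d * ((d : ℝ) + 1) * ((L : ℝ) ^ 3 * (256 * (d : ℝ) ^ 2
              * (32 * d + (24 * d * (2 * (d : ℝ) + gradRem d) + 14336 * (d : ℝ) ^ 2 * ((d : ℝ) + 1) ^ 2)
                + 12 * (2 * (d : ℝ) + gradRem d))
            + 4 * (24 * d * (2 * (d : ℝ) + gradRem d) + 14336 * (d : ℝ) ^ 2 * ((d : ℝ) + 1) ^ 2)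
            + 24 * (2 * (d : ℝ) + gradRem d)))
          + ((d : ℝ) - 1) ^ 2 * (37 * ((d : ℝ) - 1) + 5)))) * t ≤ 1)
    (hεt : 18 * ((32 * d + 48 * d * (L : ℝ) ^ 2 * (2 * (d : ℝ) + gradRem d)
              + 8192 * (d : ℝ) ^ 2 * (2 * (d : ℝ) + 1) ^ 2 * (L : ℝ) ^ 2)
            + (3 * (1280 * d * ((d : ℝ) + 1) ^ 2 * ((d : ℝ) + 4) ^ 2 * (L : ℝ) ^ 2
            * (32 * d + 48 * d * (L : ℝ) ^ 2 * (2 * (d : ℝ) + gradRem d)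
              + 8192 * (d : ℝ) ^ 2 * (2 * (d : ℝ) + 1) ^ 2 * (L : ℝ) ^ 2) ^ 2
          + d * ((d : ℝ) + 1) * ((L : ℝ) ^ 3 * (256 * (d : ℝ) ^ 2
              * (32 * d + (24 * d * (2 * (d : ℝ) + gradRem d) + 14336 * (d : ℝ) ^ 2 * ((d : ℝ) + 1) ^ 2)
                + 12 * (2 * (d : ℝ) + gradRem d))
            + 4 * (24 * d * (2 * (d : ℝ) + gradRem d) + 14336 * (d : ℝ) ^ 2 * ((d : ℝ) + 1) ^ 2)
            + 24 * (2 * (d : ℝ) + gradRem d)))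
          + ((d : ℝ) - 1) ^ 2 * (37 * ((d : ℝ) - 1) + 5)))) * (L : ℝ) ^ (d + 2) * t ≤ ε)
    (hε1 : 16 * C0 d * ε ≤ 3) (hε2 : 1024 * (d + 1) * (d + 4) * (L : ℝ) ^ 2 * ε ≤ 1)
    (hε₁ : ε₁ ≤ 1 / 4) (hε₁b : ε₁ ≤ b) (hε₁c : 4 * ε₁ ≤ c)
    {dom : Set (Site d → Fin d → (Matrix n n ℂ)ˣ)} (hdom1 : dom ⊆ sfClass d L N ε₁ 0)
    (h3 : ∀ V ∈ dom, ∀ (k : ℕ) (U : Site d → Fin d → (Matrix n n ℂ)ˣ),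
      IsMinimiser d (sfClass d L N ε) L N (k + 1) V U → RegularSup d L N b c (k + 1) U) :
    ∀ V ∈ dom, ∀ k : ℕ, ∃ U, IsMinimiser d (sfClass d L N ε) L N k V U ∧ RegularSup d L N b c k U := by
  intro V hV k
  obtain ⟨hbε, b', c', hR⟩ := smoothRefine_sfClass_thm1Type (n := n) hd N (le_trans (by norm_num) hL) hb hc hbt hct hT1 hT2
    hT3 hεt
  exact exists_regular_isMinimiser_of_smoothRefine hL hbε (hb.trans hbε) hε1 hε2 (h3 V hV)
    (regularSup_zero_of_sfClass_le hε₁ hε₁b hε₁c (hdom1 hV)) hR k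

end AnyD

/-! ## §2 The thresholds at `d = 4` below ONE displayed numeral -/

section Four

/-- **THRESHOLDS (i)(ii)(iii) AT `d = 4` FROM ONE NUMERAL**: for `L ≥ 1`, `t ≥ 0` and `2^91·L^17·t ≤ 1`, the three thresholds of
`MinimalActionThm1Type.actionRate_thm1Type_class` hold at `d = 4` (their coefficient polynomials in `L`, with `gradRem 4 = 3588`, are
`12249120 + 2621440L² + 231572766720L⁴`, `52428800L²`, `2136473600L¹¹ + 263890200994775040L¹³ + 987121062405734400L¹⁴ + 46621755923748618240000L¹⁵
+ 2059236337396052719042560000L¹⁷`; every power is `≤ L^17` and the coefficients sum to `2059282960402987964837849120 < 2^91`). [folklore] -/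
theorem thresholds_four {L : ℕ} (hL : 1 ≤ L) {t : ℝ} (ht : 0 ≤ t) (hsmall : (2 : ℝ) ^ 91 * (L : ℝ) ^ 17 * t ≤ 1) :
    (160 * (4 : ℕ) + 168 * ((4 : ℕ) : ℝ) ^ 2 + 2 * (32 * (4 : ℕ) + (24 * (4 : ℕ) * (2 * ((4 : ℕ) : ℝ) + gradRem (4 : ℕ))
            + 14336 * ((4 : ℕ) : ℝ) ^ 2 * (((4 : ℕ) : ℝ) + 1) ^ 2)
            + 12 * (2 * ((4 : ℕ) : ℝ) + gradRem (4 : ℕ)))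
        + 512 * (((4 : ℕ) : ℝ) + 1) * (((4 : ℕ) : ℝ) + 4) * (L : ℝ) ^ 2
          * (32 * (4 : ℕ) + 48 * (4 : ℕ) * (L : ℝ) ^ 2 * (2 * ((4 : ℕ) : ℝ) + gradRem (4 : ℕ))
            + 8192 * ((4 : ℕ) : ℝ) ^ 2 * (2 * ((4 : ℕ) : ℝ) + 1) ^ 2 * (L : ℝ) ^ 2)) * t ≤ 1 ∧
    2 ^ 15 * (((4 : ℕ) : ℝ) + 1) ^ 2 * (((4 : ℕ) : ℝ) + 4) ^ 2 * (L : ℝ) ^ 2 * t ≤ 1 ∧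
    2 ^ 14 * (((4 : ℕ) : ℝ) + 1) * (((4 : ℕ) : ℝ) + 4) * (L : ℝ) ^ (2 * (4 : ℕ) + 3)
          * ((32 * (4 : ℕ) + 48 * (4 : ℕ) * (L : ℝ) ^ 2 * (2 * ((4 : ℕ) : ℝ) + gradRem (4 : ℕ))
              + 8192 * ((4 : ℕ) : ℝ) ^ 2 * (2 * ((4 : ℕ) : ℝ) + 1) ^ 2 * (L : ℝ) ^ 2)
            + (3 * (1280 * (4 : ℕ) * (((4 : ℕ) : ℝ) + 1) ^ 2 * (((4 : ℕ) : ℝ) + 4) ^ 2 * (L : ℝ) ^ 2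
            * (32 * (4 : ℕ) + 48 * (4 : ℕ) * (L : ℝ) ^ 2 * (2 * ((4 : ℕ) : ℝ) + gradRem (4 : ℕ))
              + 8192 * ((4 : ℕ) : ℝ) ^ 2 * (2 * ((4 : ℕ) : ℝ) + 1) ^ 2 * (L : ℝ) ^ 2) ^ 2
          + (4 : ℕ) * (((4 : ℕ) : ℝ) + 1) * ((L : ℝ) ^ 3 * (256 * ((4 : ℕ) : ℝ) ^ 2
              * (32 * (4 : ℕ) + (24 * (4 : ℕ) * (2 * ((4 : ℕ) : ℝ) + gradRem (4 : ℕ))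
                + 14336 * ((4 : ℕ) : ℝ) ^ 2 * (((4 : ℕ) : ℝ) + 1) ^ 2)
                + 12 * (2 * ((4 : ℕ) : ℝ) + gradRem (4 : ℕ)))
            + 4 * (24 * (4 : ℕ) * (2 * ((4 : ℕ) : ℝ) + gradRem (4 : ℕ)) + 14336 * ((4 : ℕ) : ℝ) ^ 2 * (((4 : ℕ) : ℝ) + 1) ^ 2)
            + 24 * (2 * ((4 : ℕ) : ℝ) + gradRem (4 : ℕ))))
          + (((4 : ℕ) : ℝ) - 1) ^ 2 * (37 * (((4 : ℕ) : ℝ) - 1) + 5)))) * t ≤ 1 := by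
  have hL1 : (1 : ℝ) ≤ L := by exact_mod_cast hL
  have P : ∀ k : ℕ, k ≤ 17 → (L : ℝ) ^ k ≤ (L : ℝ) ^ 17 := fun k hk => pow_le_pow_right₀ hL1 hk
  have h0 : (1 : ℝ) ≤ (L : ℝ) ^ 17 := one_le_pow₀ hL1
  have h2 := P 2 (by norm_num)
  have h4 := P 4 (by norm_num)
  have h11 := P 11 (by norm_num)
  have h13 := P 13 (by norm_num)
  have h14 := P 14 (by norm_num)
  have h15 := P 15 (by norm_num)
  have key : ∀ X : ℝ, X ≤ (2 : ℝ) ^ 91 * (L : ℝ) ^ 17 → X * t ≤ 1 := fun X hX =>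
    (mul_le_mul_of_nonneg_right hX ht).trans hsmall
  refine ⟨key _ ?_, key _ ?_, key _ ?_⟩
  · have e : (160 * (4 : ℕ) + 168 * ((4 : ℕ) : ℝ) ^ 2 + 2 * (32 * (4 : ℕ) + (24 * (4 : ℕ) * (2 * ((4 : ℕ) : ℝ) + gradRem (4 : ℕ))
            + 14336 * ((4 : ℕ) : ℝ) ^ 2 * (((4 : ℕ) : ℝ) + 1) ^ 2)
            + 12 * (2 * ((4 : ℕ) : ℝ) + gradRem (4 : ℕ)))
        + 512 * (((4 : ℕ) : ℝ) + 1) * (((4 : ℕ) : ℝ) + 4) * (L : ℝ) ^ 2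
          * (32 * (4 : ℕ) + 48 * (4 : ℕ) * (L : ℝ) ^ 2 * (2 * ((4 : ℕ) : ℝ) + gradRem (4 : ℕ))
            + 8192 * ((4 : ℕ) : ℝ) ^ 2 * (2 * ((4 : ℕ) : ℝ) + 1) ^ 2 * (L : ℝ) ^ 2) : ℝ)
        = 12249120 + 2621440 * (L : ℝ) ^ 2 + 231572766720 * (L : ℝ) ^ 4 := by
      rw [gradRem_four]; push_cast; ring
    rw [e]
    have : (12249120 + 2621440 + 231572766720 : ℝ) ≤ (2 : ℝ) ^ 91 := by norm_num
    nlinarith [h0, h2, h4, this]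
  · have e : (2 ^ 15 * (((4 : ℕ) : ℝ) + 1) ^ 2 * (((4 : ℕ) : ℝ) + 4) ^ 2 * (L : ℝ) ^ 2 : ℝ) = 52428800 * (L : ℝ) ^ 2 := by
      push_cast; ring
    rw [e]
    have : (52428800 : ℝ) ≤ (2 : ℝ) ^ 91 := by norm_num
    nlinarith [h2, this]
  · have e : (2 ^ 14 * (((4 : ℕ) : ℝ) + 1) * (((4 : ℕ) : ℝ) + 4) * (L : ℝ) ^ (2 * (4 : ℕ) + 3)
          * ((32 * (4 : ℕ) + 48 * (4 : ℕ) * (L : ℝ) ^ 2 * (2 * ((4 : ℕ) : ℝ) + gradRem (4 : ℕ))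
              + 8192 * ((4 : ℕ) : ℝ) ^ 2 * (2 * ((4 : ℕ) : ℝ) + 1) ^ 2 * (L : ℝ) ^ 2)
            + (3 * (1280 * (4 : ℕ) * (((4 : ℕ) : ℝ) + 1) ^ 2 * (((4 : ℕ) : ℝ) + 4) ^ 2 * (L : ℝ) ^ 2
            * (32 * (4 : ℕ) + 48 * (4 : ℕ) * (L : ℝ) ^ 2 * (2 * ((4 : ℕ) : ℝ) + gradRem (4 : ℕ))
              + 8192 * ((4 : ℕ) : ℝ) ^ 2 * (2 * ((4 : ℕ) : ℝ) + 1) ^ 2 * (L : ℝ) ^ 2) ^ 2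
          + (4 : ℕ) * (((4 : ℕ) : ℝ) + 1) * ((L : ℝ) ^ 3 * (256 * ((4 : ℕ) : ℝ) ^ 2
              * (32 * (4 : ℕ) + (24 * (4 : ℕ) * (2 * ((4 : ℕ) : ℝ) + gradRem (4 : ℕ))
                + 14336 * ((4 : ℕ) : ℝ) ^ 2 * (((4 : ℕ) : ℝ) + 1) ^ 2)
                + 12 * (2 * ((4 : ℕ) : ℝ) + gradRem (4 : ℕ)))
            + 4 * (24 * (4 : ℕ) * (2 * ((4 : ℕ) : ℝ) + gradRem (4 : ℕ)) + 14336 * ((4 : ℕ) : ℝ) ^ 2 * (((4 : ℕ) : ℝ) + 1) ^ 2)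
            + 24 * (2 * ((4 : ℕ) : ℝ) + gradRem (4 : ℕ))))
          + (((4 : ℕ) : ℝ) - 1) ^ 2 * (37 * (((4 : ℕ) : ℝ) - 1) + 5)))) : ℝ)
        = 2136473600 * (L : ℝ) ^ 11 + 263890200994775040 * (L : ℝ) ^ 13 + 987121062405734400 * (L : ℝ) ^ 14
          + 46621755923748618240000 * (L : ℝ) ^ 15 + 2059236337396052719042560000 * (L : ℝ) ^ 17 := by
      rw [gradRem_four]; push_cast; ring
    rw [e]
    have : (2136473600 + 263890200994775040 + 987121062405734400 + 46621755923748618240000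
        + 2059236337396052719042560000 : ℝ) ≤ (2 : ℝ) ^ 91 := by norm_num
    nlinarith [h11, h13, h14, h15, this]

/-- **THE CLASS-RADIUS LETTER AT `d = 4` FROM ONE NUMERAL**: for `L ≥ 1`, `t ≥ 0` and `2^76·L^12·t ≤ ε`, the class-radius letter of
`MinimalActionThm1Type.actionRate_thm1Type_class` holds at `d = 4` (coefficient polynomial `58680L⁶ + 7247960842752L⁸ + 27112089726720L⁹ +
1280504770854912000L¹⁰ + 56558615223890608128000L¹²`, powers `≤ L^12`, coefficients summing to `56559895763021513668152 < 2^76`). [folklore] -/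
theorem classRadius_four {L : ℕ} (hL : 1 ≤ L) {t ε : ℝ} (ht : 0 ≤ t) (hεt : (2 : ℝ) ^ 76 * (L : ℝ) ^ 12 * t ≤ ε) :
    18 * ((32 * (4 : ℕ) + 48 * (4 : ℕ) * (L : ℝ) ^ 2 * (2 * ((4 : ℕ) : ℝ) + gradRem (4 : ℕ))
              + 8192 * ((4 : ℕ) : ℝ) ^ 2 * (2 * ((4 : ℕ) : ℝ) + 1) ^ 2 * (L : ℝ) ^ 2)
            + (3 * (1280 * (4 : ℕ) * (((4 : ℕ) : ℝ) + 1) ^ 2 * (((4 : ℕ) : ℝ) + 4) ^ 2 * (L : ℝ) ^ 2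
            * (32 * (4 : ℕ) + 48 * (4 : ℕ) * (L : ℝ) ^ 2 * (2 * ((4 : ℕ) : ℝ) + gradRem (4 : ℕ))
              + 8192 * ((4 : ℕ) : ℝ) ^ 2 * (2 * ((4 : ℕ) : ℝ) + 1) ^ 2 * (L : ℝ) ^ 2) ^ 2
          + (4 : ℕ) * (((4 : ℕ) : ℝ) + 1) * ((L : ℝ) ^ 3 * (256 * ((4 : ℕ) : ℝ) ^ 2
              * (32 * (4 : ℕ) + (24 * (4 : ℕ) * (2 * ((4 : ℕ) : ℝ) + gradRem (4 : ℕ))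
                + 14336 * ((4 : ℕ) : ℝ) ^ 2 * (((4 : ℕ) : ℝ) + 1) ^ 2)
                + 12 * (2 * ((4 : ℕ) : ℝ) + gradRem (4 : ℕ)))
            + 4 * (24 * (4 : ℕ) * (2 * ((4 : ℕ) : ℝ) + gradRem (4 : ℕ)) + 14336 * ((4 : ℕ) : ℝ) ^ 2 * (((4 : ℕ) : ℝ) + 1) ^ 2)
            + 24 * (2 * ((4 : ℕ) : ℝ) + gradRem (4 : ℕ))))
          + (((4 : ℕ) : ℝ) - 1) ^ 2 * (37 * (((4 : ℕ) : ℝ) - 1) + 5)))) * (L : ℝ) ^ ((4 : ℕ) + 2) * t ≤ ε := by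
  have hL1 : (1 : ℝ) ≤ L := by exact_mod_cast hL
  have P : ∀ k : ℕ, k ≤ 12 → (L : ℝ) ^ k ≤ (L : ℝ) ^ 12 := fun k hk => pow_le_pow_right₀ hL1 hk
  have h6 := P 6 (by norm_num)
  have h8 := P 8 (by norm_num)
  have h9 := P 9 (by norm_num)
  have h10 := P 10 (by norm_num)
  have e : (18 * ((32 * (4 : ℕ) + 48 * (4 : ℕ) * (L : ℝ) ^ 2 * (2 * ((4 : ℕ) : ℝ) + gradRem (4 : ℕ))
              + 8192 * ((4 : ℕ) : ℝ) ^ 2 * (2 * ((4 : ℕ) : ℝ) + 1) ^ 2 * (L : ℝ) ^ 2)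
            + (3 * (1280 * (4 : ℕ) * (((4 : ℕ) : ℝ) + 1) ^ 2 * (((4 : ℕ) : ℝ) + 4) ^ 2 * (L : ℝ) ^ 2
            * (32 * (4 : ℕ) + 48 * (4 : ℕ) * (L : ℝ) ^ 2 * (2 * ((4 : ℕ) : ℝ) + gradRem (4 : ℕ))
              + 8192 * ((4 : ℕ) : ℝ) ^ 2 * (2 * ((4 : ℕ) : ℝ) + 1) ^ 2 * (L : ℝ) ^ 2) ^ 2
          + (4 : ℕ) * (((4 : ℕ) : ℝ) + 1) * ((L : ℝ) ^ 3 * (256 * ((4 : ℕ) : ℝ) ^ 2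
              * (32 * (4 : ℕ) + (24 * (4 : ℕ) * (2 * ((4 : ℕ) : ℝ) + gradRem (4 : ℕ))
                + 14336 * ((4 : ℕ) : ℝ) ^ 2 * (((4 : ℕ) : ℝ) + 1) ^ 2)
                + 12 * (2 * ((4 : ℕ) : ℝ) + gradRem (4 : ℕ)))
            + 4 * (24 * (4 : ℕ) * (2 * ((4 : ℕ) : ℝ) + gradRem (4 : ℕ)) + 14336 * ((4 : ℕ) : ℝ) ^ 2 * (((4 : ℕ) : ℝ) + 1) ^ 2)
            + 24 * (2 * ((4 : ℕ) : ℝ) + gradRem (4 : ℕ))))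
          + (((4 : ℕ) : ℝ) - 1) ^ 2 * (37 * (((4 : ℕ) : ℝ) - 1) + 5)))) * (L : ℝ) ^ ((4 : ℕ) + 2) : ℝ)
        = 58680 * (L : ℝ) ^ 6 + 7247960842752 * (L : ℝ) ^ 8 + 27112089726720 * (L : ℝ) ^ 9
          + 1280504770854912000 * (L : ℝ) ^ 10 + 56558615223890608128000 * (L : ℝ) ^ 12 := by
    rw [gradRem_four]; push_cast; ring
  rw [e]
  have hsum : (58680 + 7247960842752 + 27112089726720 + 1280504770854912000 + 56558615223890608128000 : ℝ) ≤ (2 : ℝ) ^ 76 := by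
    norm_num
  have hle : (58680 * (L : ℝ) ^ 6 + 7247960842752 * (L : ℝ) ^ 8 + 27112089726720 * (L : ℝ) ^ 9
          + 1280504770854912000 * (L : ℝ) ^ 10 + 56558615223890608128000 * (L : ℝ) ^ 12) ≤ (2 : ℝ) ^ 76 * (L : ℝ) ^ 12 := by
    nlinarith [h6, h8, h9, h10, hsum, one_le_pow₀ (n := 12) hL1]
  exact (mul_le_mul_of_nonneg_right hle ht).trans hεt

end Four

end

end Summit.QuantumFields.BalabanUV.T4Continuum.NE7EtaBackgroundRefineThresholds
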